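import Summits.ValiantsHypothesis.ValiantsHypothesis.Theses.IntegralOrbits
import Summits.ValiantsHypothesis.ValiantsHypothesis.Theorems.IntegralOrbitsIntDetGlue
import Literature.Computability.AlgebraicComplexity.DeterminantalComplexityProofs
import Literature.Computability.AlgebraicComplexity.VPDeterminantalQPProofs
import Literature.Computability.AlgebraicComplexity.ValiantClasses
import Literature.Computability.AlgebraicComplexity.ValiantConjectureProofs

/-!
# Free-denominator glue for `IntDetQP` (stub glue' of the `IntDetQP` birth line)

Route `route-ValiantsHypothesis-IntegralOrbits`, supports item `stmt-ValiantsHypothesis-7677`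
(`IntegralOrbits.IntDetQP`).

**Statement.** `RationalCharacterNF → LiftFD → HeightToSize → IntDetQP` (the conclusion written
out), where `LiftFD` is the FREE-DENOMINATOR integral character lift: an absolutely irreducible
tuple `M : ι → M_m(ℂ)` with bounded `ℤ[1/N]`-valued character admits integer matrices `Z_v` of
size `m²`, an exponent `r ≥ 1` and a denominator `1 ≤ D ≤ 2^K`, `K = (m + #ι + h + 2)^c`, with
`|Z_v a b| ≤ 2^K` and `det (X₀·1 + Σ_v X_v Z_v / D) = det (X₀·1 + Σ_v X_v M_v)^r`.

**Proof.** This is the landed layer-1 glue `Theorems.intDetGlue_proof`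
(`Summits/.../Theorems/IntegralOrbitsIntDetGlue.lean`) re-run with the free denominator `D` in
place of `N^e`; all its public lemmas are reused by name:

1. `exists_qp_hasDetRepr_per`: `VP ℂ = VNP ℂ` gives quasi-polynomially bounded affine
   determinantal expressions of `per_n`; `RationalCharacterNF` normalises them to
   `det (1 + Σ_v (x_v − δ_v) M_v) = per_n`; `LiftFD` (at `ι = Fin n × Fin n`) lifts the tuple.
2. `map_C_div_eq_fd` rewrites `C (z / D)` as `C (z / D^1)`, so that the `N^e`-lemmas of the glue
   apply verbatim with `N := D`, `e := 1`: `det_subst_pencil` (substitute `X₀ ↦ 1`,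
   `X_v ↦ x_v − δ_v`) and `det_intModel` (the integer model `D·1 + Σ_v (x_v − δ_v) Z_v` has
   determinant `D^(m'²) · per_n^r` over `ℤ`).
3. Entries are affine (`totalDegree_intModel_le`) of height `≤ D + n²·2·2^K ≤ 2^(h·0 + K + n² + 2)`
   (`abs_coeff_intModel_le`, `height_bound_fd`); reindex to `Fin (m'·m')`, compress heights with
   `HeightToSize` and compose the quasi-polynomial bounds with `final_bound` at `e := 0`.

Output: `c = (c₁+2)c₂ + c₁ + c₂ + c₃ + c₄ + 8`, `n₀ = 0`, `d = r`, `N' = D^(1·m'²) ≠ 0`.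
-/

set_option linter.dupNamespace false -- single-conjunct summit

namespace Summit.ValiantsHypothesis.ValiantsHypothesis.Theorems

namespace IntegralOrbitsIntDetQPGlueFD

open Literature.Computability.AlgebraicComplexity MvPolynomial IntegralOrbitsIntDetGlue

/-- Rewriting the `D`-scaled integer matrices of the free-denominator lift as `C`-images of
complex matrices scaled by `D^1` (so that the `N^e`-lemmas of the glue apply with `e = 1`).
[folklore] -/
theorem map_C_div_eq_fd {ι p : Type*} (Zv : Matrix p p ℤ) (D : ℕ) :
    Zv.map (fun z : ℤ => (C ((z : ℂ) / (D : ℂ)) : MvPolynomial (Option ι) ℂ)) =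
      (Zv.map (fun z : ℤ => (z : ℂ) / (D : ℂ) ^ 1)).map (C : ℂ →+* MvPolynomial (Option ι) ℂ) := by
  rw [Matrix.map_map, pow_one]; rfl

/-- Elementary height bookkeeping for the free denominator: `D^1 + k·2·2^K ≤ 2^(h·0 + K + k + 2)`
for `D ≤ 2^K` (the shape `h·0 + …` matches `final_bound` at `e = 0`). [folklore] -/
theorem height_bound_fd (D h K k : ℕ) (hD : D ≤ 2 ^ K) :
    D ^ 1 + k * (2 * 2 ^ K) ≤ 2 ^ (h * 0 + K + k + 2) := by
  have h3 : k * (2 * 2 ^ K) ≤ 2 ^ (k + K + 1) := by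
    calc k * (2 * 2 ^ K) ≤ 2 ^ k * (2 * 2 ^ K) :=
          Nat.mul_le_mul_right _ (Nat.lt_two_pow_self (n := k)).le
      _ = 2 ^ (k + K + 1) := by ring
  rw [pow_one, mul_zero, zero_add]
  calc D + k * (2 * 2 ^ K) ≤ 2 ^ K + 2 ^ (k + K + 1) := add_le_add hD h3
    _ ≤ 2 ^ (K + k + 1) + 2 ^ (K + k + 1) :=
        add_le_add (Nat.pow_le_pow_right (by norm_num) (by omega))
          (Nat.pow_le_pow_right (by norm_num) (by omega))
    _ = 2 ^ (K + k + 2) := by ring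

end IntegralOrbitsIntDetQPGlueFD

open Summit.ValiantsHypothesis.ValiantsHypothesis.Theses.IntegralOrbits
  Literature.Computability.AlgebraicComplexity MvPolynomial IntegralOrbitsIntDetGlue
  IntegralOrbitsIntDetQPGlueFD in
/-- **Free-denominator glue** (stub glue' of the `IntDetQP` birth line, supports
`stmt-ValiantsHypothesis-7677`): `RationalCharacterNF → LiftFD → HeightToSize → IntDetQP` with the
conclusion written out. From `VP ℂ = VNP ℂ` take a quasi-polynomial affine determinantal expression
of `per_n` (`exists_qp_hasDetRepr_per`), normalise it (`RationalCharacterNF`), lift the tuple to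
integer matrices `Z_v` of size `m'²` with a free denominator `D` (`LiftFD` at `ι = Fin n × Fin n`),
substitute `X₀ ↦ 1, X_v ↦ x_v − δ_v` (`det_subst_pencil`), clear `D` row-wise and descend to `ℤ`
(`det_intModel` at `N := D, e := 1`: `det (D·1 + Σ_v (x_v − δ_v) Z_v) = D^(m'²) per_n^r`),
reindex to `Fin (m'·m')`, bound degrees and heights (`totalDegree_intModel_le`,
`abs_coeff_intModel_le`, `height_bound_fd`), compress heights to `{−1,0,1}` (`HeightToSize`) and
compose the bounds (`final_bound` at `e := 0`), with `c = (c₁+2)c₂ + c₁ + c₂ + c₃ + c₄ + 8`,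
`n₀ = 0`, `d = r`, `N' = D^(1·m'²)`. [folklore] -/
theorem stub_glueFreeDenominator :
    RationalCharacterNF →
    (∃ c : ℕ, ∀ (ι : Type) [Fintype ι] [DecidableEq ι] (m N h : ℕ) (M : ι → Matrix (Fin m) (Fin m) ℂ),
      1 ≤ N → N ≤ 2 ^ h →
      Submodule.span ℂ (Set.range fun w : List ι => (w.map M).prod) = ⊤ →
      (∀ w : List ι, ∃ (z : ℤ) (e : ℕ), ((w.map M).prod).trace = (z : ℂ) / (N : ℂ) ^ e ∧
          |z| ≤ 2 ^ (h * (w.length + 1)) ∧ e ≤ h * (w.length + 1)) →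
      ∃ (D r : ℕ) (Z : ι → Matrix (Fin m × Fin m) (Fin m × Fin m) ℤ),
        1 ≤ r ∧ 1 ≤ D ∧ D ≤ 2 ^ ((m + Fintype.card ι + h + 2) ^ c) ∧
        (∀ v a b, |Z v a b| ≤ 2 ^ ((m + Fintype.card ι + h + 2) ^ c)) ∧
        ((MvPolynomial.X none : MvPolynomial (Option ι) ℂ) •
              (1 : Matrix (Fin m × Fin m) (Fin m × Fin m) (MvPolynomial (Option ι) ℂ)) +
            ∑ v : ι, (MvPolynomial.X (some v) : MvPolynomial (Option ι) ℂ) •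
              (Z v).map (fun z : ℤ => (MvPolynomial.C ((z : ℂ) / (D : ℂ)) : MvPolynomial (Option ι) ℂ))).det =
          (((MvPolynomial.X none : MvPolynomial (Option ι) ℂ) •
                (1 : Matrix (Fin m) (Fin m) (MvPolynomial (Option ι) ℂ)) +
              ∑ v : ι, (MvPolynomial.X (some v) : MvPolynomial (Option ι) ℂ) •
                (M v).map (MvPolynomial.C : ℂ →+* MvPolynomial (Option ι) ℂ)).det) ^ r) →
    HeightToSize →
      (Literature.Computability.AlgebraicComplexity.VP ℂ = Literature.Computability.AlgebraicComplexity.VNP ℂ →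
        ∃ c n₀ : ℕ, ∀ n ≥ n₀, ∃ (m d : ℕ) (N : ℤ) (A : Matrix (Fin m) (Fin m) (MvPolynomial (Fin n × Fin n) ℤ)),
          1 ≤ d ∧ m ≤ 2 ^ ((Nat.log 2 n + c) ^ c) ∧ N ≠ 0 ∧ (∀ i j, (A i j).totalDegree ≤ 1) ∧
          (∀ i j s, |MvPolynomial.coeff s (A i j)| ≤ 1) ∧
          A.det = MvPolynomial.C N * Literature.Computability.AlgebraicComplexity.perPoly (Fin n) ℤ ^ d) := by
  intro hNF hLift hHS hEq
  obtain ⟨c₁, hc₁⟩ := exists_qp_hasDetRepr_per hEq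
  obtain ⟨c₂, hNF⟩ := hNF
  obtain ⟨c₃, hLift⟩ := hLift
  obtain ⟨c₄, hHS⟩ := hHS
  refine ⟨(c₁ + 2) * c₂ + c₁ + c₂ + c₃ + c₄ + 8, 0, fun n _ => ?_⟩
  obtain ⟨m, hm, hrepr⟩ := hc₁ n
  obtain ⟨m', N, h, M, hm', hN1, hNh, hh, hdet, hspan, hchar⟩ := hNF n m hrepr
  obtain ⟨D, r, Z, hr, hD1, hDK, hZ, hpencil⟩ :=
    hLift (Fin n × Fin n) m' N h M hN1 hNh hspan hchar
  simp only [map_C_div_eq_fd] at hpencil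
  have hQ := det_subst_pencil (fun v : Fin n × Fin n => (X v : MvPolynomial (Fin n × Fin n) ℂ) -
    C (if v.1 = v.2 then (1 : ℂ) else 0)) _ _ r hpencil
  rw [hdet] at hQ
  have hD0 : D ≠ 0 := by omega
  have hDC : (D : ℂ) ≠ 0 := by exact_mod_cast hD0
  have hδ : ∀ v : Fin n × Fin n,
      (((if v.1 = v.2 then (1 : ℤ) else 0 : ℤ)) : ℂ) = if v.1 = v.2 then (1 : ℂ) else 0 := by
    intro v; split_ifs <;> simp
  have hδ1 : ∀ v : Fin n × Fin n, |(if v.1 = v.2 then (1 : ℤ) else 0 : ℤ)| ≤ 1 := by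
    intro v; split_ifs <;> simp
  have hdetB := det_intModel (fun v : Fin n × Fin n => if v.1 = v.2 then (1 : ℤ) else 0)
    (fun v : Fin n × Fin n => if v.1 = v.2 then (1 : ℂ) else 0) hδ Z D 1 r hDC
    (perPoly (Fin n) ℤ) (by rw [map_perPoly]; exact hQ)
  have hcard : Fintype.card (Fin n × Fin n) = n * n := by simp
  have hcard' : Fintype.card (Fin m' × Fin m') = m' * m' := by simp
  rw [hcard] at hDK hZ
  rw [hcard'] at hdetB
  set B := (C ((D : ℤ) ^ 1) : MvPolynomial (Fin n × Fin n) ℤ) •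
      (1 : Matrix (Fin m' × Fin m') (Fin m' × Fin m') (MvPolynomial (Fin n × Fin n) ℤ)) +
    ∑ v : Fin n × Fin n, ((X v : MvPolynomial (Fin n × Fin n) ℤ) -
      C (if v.1 = v.2 then (1 : ℤ) else 0)) •
        (Z v).map (C : ℤ →+* MvPolynomial (Fin n × Fin n) ℤ) with hB
  set A := Matrix.reindex finProdFinEquiv finProdFinEquiv B with hA
  have hAdeg : ∀ i j, (A i j).totalDegree ≤ 1 := by
    intro i j
    simp only [hA, Matrix.reindex_apply, Matrix.submatrix_apply, hB]
    exact totalDegree_intModel_le _ _ _ _ _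
  have hAcoeff : ∀ i j s, |coeff s (A i j)| ≤
      2 ^ (h * 0 + (m' + n * n + h + 2) ^ c₃ + n * n + 2) := by
    intro i j s
    simp only [hA, Matrix.reindex_apply, Matrix.submatrix_apply, hB]
    refine (abs_coeff_intModel_le _ hδ1 Z _ _ hZ _ _ s).trans ?_
    rw [hcard, abs_pow, Nat.abs_cast]
    exact_mod_cast height_bound_fd D h ((m' + n * n + h + 2) ^ c₃) (n * n) hDK
  have hAdet : A.det = C ((D : ℤ) ^ (1 * (m' * m'))) * perPoly (Fin n) ℤ ^ r := by
    rw [hA, Matrix.det_reindex_self, hdetB]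
  obtain ⟨m'', B', hm'', hdeg', hcoeff', hdet'⟩ :=
    hHS (Fin n × Fin n) (m' * m') _ _ A hAdeg hAcoeff hAdet
  rw [hcard] at hm''
  refine ⟨m'', r, (D : ℤ) ^ (1 * (m' * m')), B', hr, ?_, ?_, hdeg', hcoeff', hdet'⟩
  · exact final_bound c₁ c₂ c₃ c₄ n m m' h 0 m'' hm hm' hh (Nat.zero_le _) hm''
  · exact pow_ne_zero _ (by exact_mod_cast hD0)

end Summit.ValiantsHypothesis.ValiantsHypothesis.Theorems
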